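import Literature.AlgebraicGeometry.ShimuraVarieties.HeckeCorrespondenceAction
import Mathlib.Topology.Algebra.ConstMulAction

/-!
# Proper discontinuity of `Γ` on the ball from the two finiteness bricks (crux
# `EndoscopicMiddleDegree.OrthogonalEnveloped`, stmt-HodgeConjecture-14300; `--supports`; seat c2, 2026-08-16)

The residual ARITHMETIC construction of the crux chain (registered `stub_properlyDiscontinuous`:
`ProperlyDiscontinuousSMul ↥D.Γ D.ball`, the input of Hecke admissibility — landed
`stub_levelCoveringOfProperlyDiscontinuous` p107526, `stub_freeOfProperlyDiscontinuous` p107635,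
`stub_ballLocallyCompactT2` p107937 — and of the analyticity of the Hecke graphs) is ASSEMBLED here from
two bricks taken as hypotheses (both registered stubs of the crux):

* (i) `stub_congruenceBoundedFinite` — only finitely many `γ ∈ Γ` have all conjugates of all entries
  bounded by a constant (congruence subgroup ⊇ `Γ(n)` of finite index; entries of `Γ(n)` integral;
  finitely many integers of bounded house, `NumberField.Embeddings.finite_of_norm_le`);
* (arch) `stub_archimedeanBound` — for compact `K, L ⊆ 𝔹`, every `γ ∈ Γ` with `γK ∩ L ≠ ∅` has all
  conjugates of all entries bounded by a constant `C(K, L)` (definite places: `U(H^τ)` is compact; the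
  place of `τ₁`: in Sylvester coordinates every entry of an element of `U(p,1)` is bounded by its corner
  entry, landed `stub_indefiniteUnitaryEntryBound` p107948, and the corner entry is bounded when the base
  point is moved into a compact set).

Then `{γ | γ • K ∩ L ≠ ∅}` is contained in a finite set: `stub_properlyDiscontinuousOfBricks`
(REGISTERED stub of the crux). References: A. Borel, *Introduction aux groupes arithmétiques* (1969), §8;
BMM arXiv:1306.1515 Part 2 §1.4.
-/

noncomputable section

-- The crux-workfile namespace `Summit.<P>.<Sub>.Cruxes.…` repeats `HodgeConjecture` (single-conjunct summit).
set_option linter.dupNamespace false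

namespace Summit.HodgeConjecture.HodgeConjecture.Cruxes.OrthogonalEnveloped.HeckeGraphChow

open Literature.AlgebraicGeometry.Motives (SchemeOver)
open Literature.AlgebraicGeometry.ShimuraVarieties

/-- **REGISTERED STUB `stub_properlyDiscontinuousOfBricks` (seat c2): `Γ` acts properly discontinuously
on the ball, given the discreteness brick (i) and the archimedean boundedness brick (arch).** For compact
`K, L`, an element `γ` moving `K` into contact with `L` satisfies `∃ b ∈ K, γ • b ∈ L`, so by (arch) all
its conjugate entries are bounded by `C(K, L)`, and by (i) only finitely many `γ` are so bounded.
[cite: BergeronMillsonMoeglin2016Balls, Part 2 §1.4] -/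
theorem stub_properlyDiscontinuousOfBricks :
    (∀ {p : ℕ} {X : SchemeOver ℂ} (D : UnitaryBallQuotientDatum p X) (C : ℝ),
      Set.Finite {γ : ↥D.Γ | ∀ (τ : D.E →+* ℂ) (i j : Fin (p + 1)),
        ‖τ ((γ : GL (Fin (p + 1)) D.E) i j)‖ ≤ C}) →
    (∀ {p : ℕ} {X : SchemeOver ℂ} (D : UnitaryBallQuotientDatum p X) (K L : Set D.ball),
      IsCompact K → IsCompact L →
      ∃ C : ℝ, ∀ γ : ↥D.Γ, (∃ b ∈ K, γ • b ∈ L) →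
        ∀ (τ : D.E →+* ℂ) (i j : Fin (p + 1)), ‖τ ((γ : GL (Fin (p + 1)) D.E) i j)‖ ≤ C) →
    ∀ {p : ℕ} {X : SchemeOver ℂ} (D : UnitaryBallQuotientDatum p X),
      ProperlyDiscontinuousSMul ↥D.Γ D.ball := by
  intro hfin harch p X D
  refine ⟨fun {K L} hK hL ↦ ?_⟩
  obtain ⟨C, hC⟩ := harch D K L hK hL
  refine (hfin D C).subset fun γ hγ ↦ ?_
  obtain ⟨x, ⟨b, hbK, rfl⟩, hxL⟩ := hγ
  exact hC γ ⟨b, hbK, hxL⟩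

end Summit.HodgeConjecture.HodgeConjecture.Cruxes.OrthogonalEnveloped.HeckeGraphChow

end
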